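import Mathlib
import Summits.MatrixMultiplication.MatrixMultiplication.Theses.LevelGradedCohnUmans
import Summits.MatrixMultiplication.MatrixMultiplication.Theorems.LevelGradedCohnUmansSnLevelDesignsStubGarnirVanishing

/-!
# `SnLevelDesigns` (stmt-MatrixMultiplication-7613), line `garnir-annihilator`:
# M3 `stub_garnirFreeMiddle` — the middle difference set contains no Young subgroup of excess ≥ k+1

Crux `Summit.MatrixMultiplication.MatrixMultiplication.Theses.LevelGradedCohnUmans.SnLevelDesigns`;
skeleton `Cruxes/SnLevelDesigns/Lines/garnir_annihilator.lean` (lead c3 reshape 6, registered stub M3);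
this file proves the registered stub `stub_garnirFreeMiddle` verbatim and lands `--supports stmt-MatrixMultiplication-7613`.

If `(X, Y, Z)` is `k`-token separated with `X, Z ≠ ∅` and `blk : Fin n → Fin n` is a block labelling with
`#image blk + k + 1 ≤ n` (excess `≥ k+1`), then NOT every `σ` of the Young subgroup `{σ | ∀ a, blk (σ a) = blk a}` is a middle
difference `y y'⁻¹`. Proof: the landed S1 `stub_garnirVanishing` (p79352) with `a := x₀⁻¹`, `b := z₀` and the separator `c` of
`(x₀, z₀)` gives `Σ_{σ ∈ stab} sgn(σ) · f_c(x₀⁻¹ σ z₀) = 0`; but `f_c(x₀⁻¹ σ z₀) = [σ = 1]` (for `σ = y y'⁻¹ ≠ 1` it is the garbage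
`(x₀, y, y', z₀)`: `x₀⁻¹ * y * y'⁻¹ * z₀ = x₀⁻¹ * σ * z₀`; for `σ = 1 = y y⁻¹` it is the target), so the sum is `1`.
-/

set_option linter.dupNamespace false

namespace Summit.MatrixMultiplication.MatrixMultiplication.Theorems.SnLevelDesigns

open scoped BigOperators

/-- **`stub_garnirFreeMiddle`** (registered stub M3 of crux stmt-MatrixMultiplication-7613, line
`garnir-annihilator`, lead c3 reshape 6; verbatim). If `(X, Y, Z)` is `k`-token separated (hypothesis 4:
every target `(x₀, z₀)` has a coefficient table `c` whose token function `g ↦ ∑ p, c p (g ∘ p)` is `1` on the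
target products and `0` on all other quadruple products `x⁻¹ * y * y'⁻¹ * z`), `X, Z ≠ ∅`, and
`blk : Fin n → Fin n` is a block labelling of excess `≥ k + 1` (`#image blk + k + 1 ≤ n`), then the middle
difference set `{y * y'⁻¹ | y, y' ∈ Y}` does NOT contain the whole Young subgroup `{σ | ∀ a, blk (σ a) = blk a}`.
Proof: Garnir vanishing (`stub_garnirVanishing`, S1) with `a := x₀⁻¹`, `b := z₀` says the signed sum of the
token function over `x₀⁻¹ · S_blk · z₀` is `0`, while separation evaluates each summand to `[σ = 1]`
(`σ = y * y'⁻¹` and `x₀⁻¹ * y * y'⁻¹ * z₀ = x₀⁻¹ * σ * z₀`), so the sum is `sign 1 · 1 = 1`. -/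
theorem stub_garnirFreeMiddle :
    ∀ (n k : ℕ) (X Y Z : Finset (Equiv.Perm (Fin n))) (blk : Fin n → Fin n),
      (Finset.univ.image blk).card + k + 1 ≤ n → X.Nonempty → Z.Nonempty →
        (∀ x₀ ∈ X, ∀ z₀ ∈ Z, ∃ c : (Fin k → Fin n) → (Fin k → Fin n) → ℂ,
            ∀ x ∈ X, ∀ y ∈ Y, ∀ y' ∈ Y, ∀ z ∈ Z,
              (∑ p : Fin k → Fin n, c p (⇑(x⁻¹ * y * y'⁻¹ * z) ∘ p)) = if x = x₀ ∧ y = y' ∧ z = z₀ then 1 else 0) →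
          ¬ (∀ σ ∈ Finset.univ.filter (fun σ : Equiv.Perm (Fin n) => ∀ a, blk (σ a) = blk a),
              ∃ y ∈ Y, ∃ y' ∈ Y, σ = y * y'⁻¹) := by
  intro n k X Y Z blk hexc hX hZ hsep hmid
  classical
  obtain ⟨x₀, hx₀⟩ := hX
  obtain ⟨z₀, hz₀⟩ := hZ
  obtain ⟨c, hc⟩ := hsep x₀ hx₀ z₀ hz₀
  -- each summand of the Garnir sum through the target `(x₀, z₀)` evaluates to `[σ = 1]`
  have hval : ∀ σ ∈ Finset.univ.filter (fun σ : Equiv.Perm (Fin n) => ∀ a, blk (σ a) = blk a),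
      ((Equiv.Perm.sign σ : ℤ) : ℂ) * ∑ p : Fin k → Fin n, c p (⇑(x₀⁻¹ * σ * z₀) ∘ p) =
        if σ = 1 then 1 else 0 := by
    intro σ hσ
    obtain ⟨y, hy, y', hy', rfl⟩ := hmid σ hσ
    have h := hc x₀ hx₀ y hy y' hy' z₀ hz₀
    have hrw : x₀⁻¹ * y * y'⁻¹ * z₀ = x₀⁻¹ * (y * y'⁻¹) * z₀ := by rw [mul_assoc x₀⁻¹ y y'⁻¹]
    rw [hrw] at h
    rw [h]
    by_cases h1 : y * y'⁻¹ = 1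
    · have hyy : y = y' := mul_inv_eq_one.mp h1
      subst hyy
      simp
    · have hne : ¬ (x₀ = x₀ ∧ y = y' ∧ z₀ = z₀) := by
        rintro ⟨-, h2, -⟩
        exact h1 (mul_inv_eq_one.mpr h2)
      rw [if_neg hne, if_neg h1, mul_zero]
  have hsum := stub_garnirVanishing n k blk hexc c x₀⁻¹ z₀
  have hone : (1 : Equiv.Perm (Fin n)) ∈
      Finset.univ.filter (fun σ : Equiv.Perm (Fin n) => ∀ a, blk (σ a) = blk a) := by
    simp
  rw [Finset.sum_congr rfl hval, Finset.sum_ite_eq' _ (1 : Equiv.Perm (Fin n)) (fun _ => (1 : ℂ)),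
    if_pos hone] at hsum
  exact one_ne_zero hsum

end Summit.MatrixMultiplication.MatrixMultiplication.Theorems.SnLevelDesigns
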